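import Mathlib
import Literature.AlgebraicGeometry.HodgeTheory.AbelianVarietyEndomorphismsHOne
import HarnessLib

/-!
# BiquadraticSecantLift · X2 `BiquadraticBaseChangeHyperbolic` — the algebra of the biquadratic polynomial
# `R_(d,m)(S) = S² + 2d(1+m)·S + d²(m-1)²`

Helper file for crux X2 (item stmt-HodgeConjecture-22133) of route-HodgeConjecture-BiquadraticSecantLift. The route's
endomorphism `η_(d,m) = (φ ⊞ φ) ≫ (𝟙 + ψ_m)` of `A ⊞ A` (`φ² = -d`, `ψ_m² = m`) satisfies `η² = -d(1 + ψ_m)²`, whose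
minimal polynomial over `ℚ` is `R_(d,m)`; `E = ℚ(η) = ℚ[T]/(R_(d,m)(T²)) = ℚ(√-d, √m)` is the biquadratic CM field with
totally real subfield `F = ℚ(η²) = ℚ(√m)`. This file proves the four ALGEBRAIC clauses of the tree's
`Deligne1982.IsWeilTypeCM (A ⊞ A) η R_(d,m) 2 3` — `R` monic of degree `2`, its roots `-d(1 ± √m)²` real and
negative, and `R(T²) = T⁴ + 2d(1+m)T² + d²(m-1)²` irreducible over `ℚ` when `d ≥ 1` and `m ≥ 1` is not a square —
together with the factorisation of `R` over `ℂ` and the location of the four roots `± i√d(1 ± √m)` of `R(T²)`.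
Pure polynomial algebra: no abelian variety occurs; nothing here is a case of the Hodge conjecture (HC is NOT proved).

## References
[cite: Deligne1982HodgeCycles, §4 p. 30 (CM fields `E = F(η)`, `η² ∈ F` totally negative)]
[cite: DummitFoote2004, §14.6 Exercise 13 (irreducibility of even quartics `x⁴ + ax² + b`)]
-/

-- every declaration of this problem lives in `Summit.HodgeConjecture.HodgeConjecture.…` (summit = sub-problem)
set_option linter.dupNamespace false

noncomputable section

open Polynomial
open Literature.AlgebraicGeometry.HodgeTheory (I_mul_sqrt_sq)

namespace Summit.HodgeConjecture.HodgeConjecture.BiquadraticSecantLift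

/-! ## §1 `R_(d,m)` is monic of degree `2` -/

/-- `R_(d,m) = S² + 2d(1+m)S + d²(m-1)²` is monic. -/
theorem bq_monic (d m : ℕ) :
    (X ^ 2 + C (2 * (d : ℤ) * (1 + (m : ℤ))) * X + C ((d : ℤ) ^ 2 * ((m : ℤ) - 1) ^ 2) : ℤ[X]).Monic := by
  monicity!

/-- `R_(d,m)` has degree `2` (`e₀ = [F:ℚ] = 2`). -/
theorem bq_natDegree (d m : ℕ) :
    (X ^ 2 + C (2 * (d : ℤ) * (1 + (m : ℤ))) * X + C ((d : ℤ) ^ 2 * ((m : ℤ) - 1) ^ 2) : ℤ[X]).natDegree = 2 := by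
  compute_degree!

/-! ## §2 The roots of `R_(d,m)` are real and negative -/

/-- A non-square natural number is not `1`. -/
theorem ne_one_of_not_isSquare {m : ℕ} (hm : ¬ IsSquare m) : m ≠ 1 := by
  rintro rfl; exact hm ⟨1, rfl⟩

/-- A non-square natural number is not `0`. -/
theorem ne_zero_of_not_isSquare {m : ℕ} (hm : ¬ IsSquare m) : m ≠ 0 := by
  rintro rfl; exact hm ⟨0, rfl⟩

/-- `√m · √m = m` in `ℂ`. -/
theorem sqrt_mul_sqrt_natCast (m : ℕ) : ((Real.sqrt m : ℝ) : ℂ) * (Real.sqrt m : ℂ) = (m : ℂ) := by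
  rw [← Complex.ofReal_mul, Real.mul_self_sqrt (Nat.cast_nonneg m), Complex.ofReal_natCast]

/-- For `m` not a square, `√m ≠ 1`, i.e. `1 - √m ≠ 0`. -/
theorem one_sub_sqrt_ne_zero {m : ℕ} (hm : ¬ IsSquare m) : (1 : ℝ) - Real.sqrt m ≠ 0 := by
  intro h
  have h1 : Real.sqrt m = 1 := by linarith
  have h2 := Real.sq_sqrt (Nat.cast_nonneg m)
  rw [h1, one_pow] at h2
  exact ne_one_of_not_isSquare hm (by exact_mod_cast h2.symm)

/-- `1 + √m ≠ 0` (indeed `> 0`). -/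
theorem one_add_sqrt_ne_zero (m : ℕ) : (1 : ℝ) + Real.sqrt m ≠ 0 := by
  have := Real.sqrt_nonneg (m : ℝ)
  intro h; linarith

/-- **`R_(d,m)(s) = (s + d(1-√m)²)(s + d(1+√m)²)` over `ℂ`.** -/
theorem bq_eval₂_eq_mul (d m : ℕ) (s : ℂ) :
    eval₂ (Int.castRingHom ℂ) s
        (X ^ 2 + C (2 * (d : ℤ) * (1 + (m : ℤ))) * X + C ((d : ℤ) ^ 2 * ((m : ℤ) - 1) ^ 2) : ℤ[X]) =
      (s + (d : ℂ) * (((1 : ℝ) - Real.sqrt m : ℝ) : ℂ) ^ 2) * (s + (d : ℂ) * (((1 : ℝ) + Real.sqrt m : ℝ) : ℂ) ^ 2) := by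
  have hm := sqrt_mul_sqrt_natCast m
  simp only [eval₂_add, eval₂_mul, eval₂_X_pow, eval₂_X, eval₂_C]
  simp only [eq_intCast, Int.cast_mul, Int.cast_ofNat, Int.cast_natCast, Int.cast_add, Int.cast_one, Int.cast_pow,
    Int.cast_sub, Complex.ofReal_sub, Complex.ofReal_add, Complex.ofReal_one]
  linear_combination (-(2 * (d : ℂ) * s + (d : ℂ) ^ 2 * ((m : ℂ) + (Real.sqrt m : ℂ) * (Real.sqrt m : ℂ) - 2))) * hm

/-- **The roots of `R_(d,m)` are real and negative** (`d ≥ 1`, `m` not a square): they are `-d(1 ± √m)²` with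
`1 ± √m ≠ 0` — the clause `root_real_neg` of `Deligne1982.IsWeilTypeCM` (`F = ℚ(η²)` totally real, `η²` totally
negative). -/
theorem bq_root_real_neg {d m : ℕ} (hd : 0 < d) (hm : ¬ IsSquare m) (s : ℂ)
    (hs : eval₂ (Int.castRingHom ℂ) s
        (X ^ 2 + C (2 * (d : ℤ) * (1 + (m : ℤ))) * X + C ((d : ℤ) ^ 2 * ((m : ℤ) - 1) ^ 2) : ℤ[X]) = 0) :
    s.im = 0 ∧ s.re < 0 := by
  rw [bq_eval₂_eq_mul, mul_eq_zero] at hs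
  have hdpos : (0 : ℝ) < d := by exact_mod_cast hd
  -- `s = -d ε²` with `ε ≠ 0` real is a negative real number
  have key : ∀ ε : ℝ, ε ≠ 0 → s + (d : ℂ) * (ε : ℂ) ^ 2 = 0 → s.im = 0 ∧ s.re < 0 := by
    intro ε hε h
    have hs' : s = -((d : ℂ) * (ε : ℂ) ^ 2) := eq_neg_of_add_eq_zero_left h
    have hε2 : (0 : ℝ) < ε ^ 2 := by positivity
    rw [hs']
    refine ⟨?_, ?_⟩
    · rw [Complex.neg_im, ← Complex.ofReal_natCast, ← Complex.ofReal_pow, ← Complex.ofReal_mul,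
        Complex.ofReal_im, neg_zero]
    · rw [Complex.neg_re, ← Complex.ofReal_natCast, ← Complex.ofReal_pow, ← Complex.ofReal_mul,
        Complex.ofReal_re, neg_lt_zero]
      exact mul_pos hdpos hε2
  rcases hs with h | h
  · exact key _ (one_sub_sqrt_ne_zero hm) h
  · exact key _ (one_add_sqrt_ne_zero m) h

/-! ## §3 `R_(d,m)(T²)` and its four complex roots `± i√d(1 ± √m)` -/

/-- `R_(d,m)(T²) = T⁴ + 2d(1+m)T² + d²(m-1)²` in `ℤ[T]`. -/
theorem bq_comp_X_sq (d m : ℕ) :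
    (X ^ 2 + C (2 * (d : ℤ) * (1 + (m : ℤ))) * X + C ((d : ℤ) ^ 2 * ((m : ℤ) - 1) ^ 2) : ℤ[X]).comp (X ^ 2) =
      X ^ 4 + C (2 * (d : ℤ) * (1 + (m : ℤ))) * X ^ 2 + C ((d : ℤ) ^ 2 * ((m : ℤ) - 1) ^ 2) := by
  simp only [add_comp, mul_comp, pow_comp, X_comp, C_comp]
  ring

/-- `R_(d,m)(ρ²)` factorised: `R_(d,m)(T²)(ρ) = (ρ² + d(1-√m)²)(ρ² + d(1+√m)²)`. -/
theorem bq_comp_eval₂_eq_mul (d m : ℕ) (ρ : ℂ) :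
    eval₂ (Int.castRingHom ℂ) ρ
        ((X ^ 2 + C (2 * (d : ℤ) * (1 + (m : ℤ))) * X + C ((d : ℤ) ^ 2 * ((m : ℤ) - 1) ^ 2) : ℤ[X]).comp (X ^ 2)) =
      (ρ ^ 2 + (d : ℂ) * (((1 : ℝ) - Real.sqrt m : ℝ) : ℂ) ^ 2) *
        (ρ ^ 2 + (d : ℂ) * (((1 : ℝ) + Real.sqrt m : ℝ) : ℂ) ^ 2) := by
  rw [eval₂_comp, eval₂_X_pow, bq_eval₂_eq_mul]

/-- `ρ² = μ²` forces `ρ = ± μ`. -/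
theorem eq_or_eq_neg_of_sq_eq_sq' {ρ μ : ℂ} (h : ρ ^ 2 = μ ^ 2) : ρ = μ ∨ ρ = -μ := by
  have h' : (ρ - μ) * (ρ + μ) = 0 := by linear_combination h
  rcases mul_eq_zero.1 h' with h1 | h1
  · exact Or.inl (sub_eq_zero.1 h1)
  · exact Or.inr (eq_neg_of_add_eq_zero_left h1)

/-- `μ² = -d` for `μ = ± i√d`. -/
theorem sq_eq_neg_of_root_sign {d : ℕ} {μ : ℂ}
    (hμ : μ = Complex.I * (Real.sqrt d : ℂ) ∨ μ = -(Complex.I * (Real.sqrt d : ℂ))) : μ ^ 2 = -(d : ℂ) := by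
  rcases hμ with rfl | rfl
  · exact I_mul_sqrt_sq d
  · rw [neg_sq]; exact I_mul_sqrt_sq d

/-- `λ² = m` for `λ = ± √m`. -/
theorem sq_eq_of_sqrt_sign {m : ℕ} {lam : ℂ} (hlam : lam = (Real.sqrt m : ℂ) ∨ lam = -(Real.sqrt m : ℂ)) :
    lam ^ 2 = (m : ℂ) := by
  have h : ((Real.sqrt m : ℝ) : ℂ) ^ 2 = (m : ℂ) := by rw [sq]; exact sqrt_mul_sqrt_natCast m
  rcases hlam with rfl | rfl
  · exact h
  · rw [neg_sq]; exact h

/-- For `m` not a square, `± √m ≠ ∓ 1`: `1 + λ ≠ 0` and `1 - λ ≠ 0`. -/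
theorem one_add_ne_zero_of_sqrt_sign {m : ℕ} (hm : ¬ IsSquare m) {lam : ℂ}
    (hlam : lam = (Real.sqrt m : ℂ) ∨ lam = -(Real.sqrt m : ℂ)) : 1 + lam ≠ 0 ∧ 1 - lam ≠ 0 := by
  have h1 : (1 : ℂ) + (Real.sqrt m : ℂ) ≠ 0 := by
    rw [← Complex.ofReal_one, ← Complex.ofReal_add, Complex.ofReal_ne_zero]; exact one_add_sqrt_ne_zero m
  have h2 : (1 : ℂ) - (Real.sqrt m : ℂ) ≠ 0 := by
    rw [← Complex.ofReal_one, ← Complex.ofReal_sub, Complex.ofReal_ne_zero]; exact one_sub_sqrt_ne_zero hm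
  rcases hlam with rfl | rfl
  · exact ⟨h1, h2⟩
  · refine ⟨by rwa [← sub_eq_add_neg], by rwa [sub_neg_eq_add]⟩

/-- **The complex roots of `R_(d,m)(T²)` are `μ(1 + λ)` with `μ = ± i√d`, `λ = ± √m`** (i.e. `± i√d(1 ± √m)`). -/
theorem bq_comp_root_eq {d m : ℕ} (ρ : ℂ)
    (hρ : eval₂ (Int.castRingHom ℂ) ρ
        ((X ^ 2 + C (2 * (d : ℤ) * (1 + (m : ℤ))) * X + C ((d : ℤ) ^ 2 * ((m : ℤ) - 1) ^ 2) : ℤ[X]).comp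
          (X ^ 2)) = 0) :
    ∃ μ lam : ℂ, (μ = Complex.I * (Real.sqrt d : ℂ) ∨ μ = -(Complex.I * (Real.sqrt d : ℂ))) ∧
      (lam = (Real.sqrt m : ℂ) ∨ lam = -(Real.sqrt m : ℂ)) ∧ ρ = μ * (1 + lam) := by
  rw [bq_comp_eval₂_eq_mul, mul_eq_zero] at hρ
  have hd := I_mul_sqrt_sq d
  have key : ∀ lam : ℂ, (lam = (Real.sqrt m : ℂ) ∨ lam = -(Real.sqrt m : ℂ)) →
      ρ ^ 2 + (d : ℂ) * (1 + lam) ^ 2 = 0 →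
      ∃ μ lam : ℂ, (μ = Complex.I * (Real.sqrt d : ℂ) ∨ μ = -(Complex.I * (Real.sqrt d : ℂ))) ∧
        (lam = (Real.sqrt m : ℂ) ∨ lam = -(Real.sqrt m : ℂ)) ∧ ρ = μ * (1 + lam) := by
    intro lam hlam h
    have h2 : ρ ^ 2 = (Complex.I * (Real.sqrt d : ℂ) * (1 + lam)) ^ 2 := by
      linear_combination h - (1 + lam) ^ 2 * hd
    rcases eq_or_eq_neg_of_sq_eq_sq' h2 with h1 | h1
    · exact ⟨_, lam, Or.inl rfl, hlam, h1⟩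
    · exact ⟨_, lam, Or.inr rfl, hlam, by rw [h1]; ring⟩
  rcases hρ with h | h
  · refine key (-(Real.sqrt m : ℂ)) (Or.inr rfl) ?_
    rw [Complex.ofReal_sub, Complex.ofReal_one] at h
    linear_combination h
  · refine key (Real.sqrt m : ℂ) (Or.inl rfl) ?_
    rw [Complex.ofReal_add, Complex.ofReal_one] at h
    exact h

/-- Conversely `μ(1 + λ)` (`μ = ± i√d`, `λ = ± √m`) is a root of `R_(d,m)(T²)`. -/
theorem bq_comp_eval₂_eq_zero_of_root (d m : ℕ) {μ lam : ℂ}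
    (hμ : μ = Complex.I * (Real.sqrt d : ℂ) ∨ μ = -(Complex.I * (Real.sqrt d : ℂ)))
    (hlam : lam = (Real.sqrt m : ℂ) ∨ lam = -(Real.sqrt m : ℂ)) :
    eval₂ (Int.castRingHom ℂ) (μ * (1 + lam))
        ((X ^ 2 + C (2 * (d : ℤ) * (1 + (m : ℤ))) * X + C ((d : ℤ) ^ 2 * ((m : ℤ) - 1) ^ 2) : ℤ[X]).comp
          (X ^ 2)) = 0 := by
  rw [bq_comp_eval₂_eq_mul, Complex.ofReal_sub, Complex.ofReal_add, Complex.ofReal_one]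
  have hμ2 : μ ^ 2 = -(d : ℂ) := sq_eq_neg_of_root_sign hμ
  rcases hlam with rfl | rfl
  · apply mul_eq_zero_of_right
    linear_combination (1 + (Real.sqrt m : ℂ)) ^ 2 * hμ2
  · apply mul_eq_zero_of_left
    linear_combination (1 - (Real.sqrt m : ℂ)) ^ 2 * hμ2

/-! ## §4 `R_(d,m)(T²)` is irreducible over `ℚ` (`d ≥ 1`, `m` not a square) -/

/-- **No integer root**: `t⁴ + 2d(1+m)t² + d²(m-1)² > 0`. -/
theorem bq_quartic_eval_ne_zero {d m : ℕ} (hd : 0 < d) (hm : ¬ IsSquare m) (t : ℤ) :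
    eval t (X ^ 4 + C (2 * (d : ℤ) * (1 + (m : ℤ))) * X ^ 2 + C ((d : ℤ) ^ 2 * ((m : ℤ) - 1) ^ 2) : ℤ[X]) ≠ 0 := by
  simp only [eval_add, eval_mul, eval_pow, eval_X, eval_C]
  have hm1 : (m : ℤ) - 1 ≠ 0 := by
    have := ne_one_of_not_isSquare hm
    omega
  have hd' : (0 : ℤ) < d := by exact_mod_cast hd
  have h1 : (0 : ℤ) < (d : ℤ) ^ 2 * ((m : ℤ) - 1) ^ 2 := by positivity
  have h2 : (0 : ℤ) ≤ t ^ 4 + 2 * (d : ℤ) * (1 + (m : ℤ)) * t ^ 2 := by positivity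
  intro h
  linarith

/-- **No factorisation into two monic quadratics over `ℤ`.** Comparing `(X² + pX + r)(X² + p'X + r')` with
`X⁴ + 2d(1+m)X² + d²(m-1)²` (evaluated at `0, ±1, 2`) gives `p' = -p`, `p(r' - r) = 0`, `r + r' - p² = 2d(1+m)`,
`rr' = d²(m-1)²`; `p = 0` makes `(r - r')² = 16d²m`, so `m` is a square; `r' = r` makes `p² ∈ {-4d, -4dm}`.
[cite: DummitFoote2004, §14.6 Exercise 13] -/
theorem bq_quartic_ne_mul_quadratic {d m : ℕ} (hd : 0 < d) (hm : ¬ IsSquare m) (p r p' r' : ℤ) :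
    (X ^ 4 + C (2 * (d : ℤ) * (1 + (m : ℤ))) * X ^ 2 + C ((d : ℤ) ^ 2 * ((m : ℤ) - 1) ^ 2) : ℤ[X]) ≠
      (X ^ 2 + C p * X + C r) * (X ^ 2 + C p' * X + C r') := by
  intro h
  have h0 := congrArg (eval 0) h
  have h1 := congrArg (eval 1) h
  have h1' := congrArg (eval (-1)) h
  have h2 := congrArg (eval 2) h
  simp only [eval_add, eval_mul, eval_pow, eval_X, eval_C] at h0 h1 h1' h2
  have hd' : (0 : ℤ) < d := by exact_mod_cast hd
  have hm' : (0 : ℤ) < m := by exact_mod_cast Nat.pos_of_ne_zero (ne_zero_of_not_isSquare hm)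
  -- the four coefficient identities
  have e3 : 6 * (p + p') = 0 := by linear_combination -h2 - 3 * h0 + 3 * h1 + h1'
  have e2 : 2 * (r + r' + p * p') = 4 * (d : ℤ) * (1 + (m : ℤ)) := by linear_combination -h1 - h1' + 2 * h0
  have e1 : 6 * (p * r' + p' * r) = 0 := by linear_combination -6 * h1 + 2 * h1' + h2 + 3 * h0
  have e0 : r * r' = (d : ℤ) ^ 2 * ((m : ℤ) - 1) ^ 2 := by linear_combination -h0
  have hp' : p' = -p := by omega
  subst hp'
  have e1' : p * (r' - r) = 0 := by
    have h6 : p * r' + -p * r = 0 := (mul_eq_zero.1 e1).resolve_left (by norm_num)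
    linear_combination h6
  rcases mul_eq_zero.1 e1' with hp | hrr
  · -- `p = 0`: `(r - r')² = 16 d² m`, so `m` is a square
    subst hp
    have esum : r + r' = 2 * (d : ℤ) * (1 + (m : ℤ)) := by
      have e2' : 2 * (r + r') = 2 * (2 * (d : ℤ) * (1 + (m : ℤ))) := by linear_combination e2
      exact mul_left_cancel₀ two_ne_zero e2'
    have esq : (4 * (d : ℤ)) ^ 2 * (m : ℤ) = (r - r') ^ 2 := by
      linear_combination (-(r + r') - 2 * (d : ℤ) * (1 + (m : ℤ))) * esum + 4 * e0
    have hdvd : 4 * (d : ℤ) ∣ r - r' := by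
      have h2' : (4 * (d : ℤ)) ^ 2 ∣ (r - r') ^ 2 := ⟨(m : ℤ), esq.symm⟩
      exact (Int.pow_dvd_pow_iff two_ne_zero).1 h2'
    obtain ⟨y, hy⟩ := hdvd
    have esq' : (4 * (d : ℤ)) ^ 2 * (m : ℤ) = (4 * (d : ℤ)) ^ 2 * y ^ 2 := by rw [esq, hy]; ring
    have h16 : (4 * (d : ℤ)) ^ 2 ≠ 0 := by positivity
    have hmy : (m : ℤ) = y ^ 2 := mul_left_cancel₀ h16 esq'
    apply hm
    rw [← Int.isSquare_natCast_iff]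
    exact ⟨y, by rw [hmy, sq]⟩
  · -- `r' = r`: `r² = d²(m-1)²` and `p² = 2r - 2d(1+m) < 0`
    have hr : r = r' := by linear_combination -hrr
    subst hr
    have ep : p ^ 2 = 2 * r - 2 * (d : ℤ) * (1 + (m : ℤ)) := by
      have e2' : 2 * (p ^ 2) = 2 * (2 * r - 2 * (d : ℤ) * (1 + (m : ℤ))) := by linear_combination -e2
      exact mul_left_cancel₀ two_ne_zero e2'
    have er : r ^ 2 = ((d : ℤ) * ((m : ℤ) - 1)) ^ 2 := by linear_combination e0
    have hp2 : 0 ≤ p ^ 2 := sq_nonneg p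
    rcases eq_or_eq_neg_of_sq_eq_sq _ _ er with h | h
    · rw [h] at ep
      nlinarith
    · rw [h] at ep
      nlinarith

/-- **`R_(d,m)(T²) = T⁴ + 2d(1+m)T² + d²(m-1)²` is irreducible over `ℤ`** for `d ≥ 1` and `m` not a square (no
integer root, no pair of monic quadratic factors). [cite: DummitFoote2004, §14.6 Exercise 13] -/
theorem bq_quartic_irreducible {d m : ℕ} (hd : 0 < d) (hm : ¬ IsSquare m) :
    Irreducible (X ^ 4 + C (2 * (d : ℤ) * (1 + (m : ℤ))) * X ^ 2 + C ((d : ℤ) ^ 2 * ((m : ℤ) - 1) ^ 2) : ℤ[X]) := by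
  have hmon : (X ^ 4 + C (2 * (d : ℤ) * (1 + (m : ℤ))) * X ^ 2 + C ((d : ℤ) ^ 2 * ((m : ℤ) - 1) ^ 2) : ℤ[X]).Monic := by
    monicity!
  have hdeg : (X ^ 4 + C (2 * (d : ℤ) * (1 + (m : ℤ))) * X ^ 2 + C ((d : ℤ) ^ 2 * ((m : ℤ) - 1) ^ 2) : ℤ[X]).natDegree
      = 4 := by
    compute_degree!
  refine hmon.irreducible_iff_natDegree'.mpr ⟨?_, ?_⟩
  · intro h
    have := congrArg natDegree h
    rw [hdeg, natDegree_one] at this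
    exact absurd this (by norm_num)
  intro g h hg hh hfac
  rw [hdeg]
  simp only [Nat.reduceDiv, Finset.mem_Ioc, not_and, not_le]
  intro h0
  have hsum : g.natDegree + h.natDegree = 4 := by
    have := congrArg natDegree hfac
    rwa [hg.natDegree_mul hh, hdeg] at this
  by_contra hle
  push Not at hle
  interval_cases hhd : h.natDegree
  · -- a monic linear factor gives an integer root
    have heq : h = X + C (h.coeff 0) := hh.eq_X_add_C hhd
    have hroot : eval (-h.coeff 0)
        (X ^ 4 + C (2 * (d : ℤ) * (1 + (m : ℤ))) * X ^ 2 + C ((d : ℤ) ^ 2 * ((m : ℤ) - 1) ^ 2) : ℤ[X]) = 0 := by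
      rw [← hfac, eval_mul, heq]
      simp
    exact bq_quartic_eval_ne_zero hd hm _ hroot
  · -- two monic quadratics
    have hgd : g.natDegree = 2 := by omega
    have heg : g = X ^ 2 + C (g.coeff 1) * X + C (g.coeff 0) := by
      conv_lhs => rw [hg.as_sum, hgd]
      simp [Finset.sum_range_succ]
      ring
    have heh : h = X ^ 2 + C (h.coeff 1) * X + C (h.coeff 0) := by
      conv_lhs => rw [hh.as_sum, hhd]
      simp [Finset.sum_range_succ]
      ring
    exact bq_quartic_ne_mul_quadratic hd hm (g.coeff 1) (g.coeff 0) (h.coeff 1) (h.coeff 0)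
      (by rw [← hfac, ← heg, ← heh])

/-- **`R_(d,m)(T²)` is irreducible over `ℚ`** (Gauss) — the clause `irreducible` of `Deligne1982.IsWeilTypeCM`:
`E = ℚ[T]/(R_(d,m)(T²)) = ℚ(√-d, √m)` is a field of degree `4`. [cite: DummitFoote2004, §14.6 Exercise 13] -/
theorem bq_comp_irreducible {d m : ℕ} (hd : 0 < d) (hm : ¬ IsSquare m) :
    Irreducible (((X ^ 2 + C (2 * (d : ℤ) * (1 + (m : ℤ))) * X + C ((d : ℤ) ^ 2 * ((m : ℤ) - 1) ^ 2) : ℤ[X]).comp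
      (X ^ 2)).map (Int.castRingHom ℚ)) := by
  rw [bq_comp_X_sq]
  have hmon : (X ^ 4 + C (2 * (d : ℤ) * (1 + (m : ℤ))) * X ^ 2 + C ((d : ℤ) ^ 2 * ((m : ℤ) - 1) ^ 2) : ℤ[X]).Monic := by
    monicity!
  exact (hmon.irreducible_iff_irreducible_map_fraction_map).mp (bq_quartic_irreducible hd hm)

end Summit.HodgeConjecture.HodgeConjecture.BiquadraticSecantLift
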